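import Mathlib

/-!
# SoloBlind kernel #137 — unavoidable leaf resonance (s78, §24.88(1))

The formal step from "a REAL top multiplier family of the leaf monodromy is net-unstable somewhere"
to "the steady leaf operator has an exact resonance `μ = 1` inside the live band":

* `real_crossing_exists`: a continuous real multiplier `μ(P)` with `μ(P₁) < 1 < μ(P₂)` equals `1`
  at some `P* ∈ [P₁, P₂]`;
* `resonant_leaf_exists`: if the pattern parameter `P(c)` is continuous across the live band
  `[c₀, c₁]`, vanishes at the contact leaf `c₀` and exceeds `P*` at `c₁` (large `n`), some leaf
  carries `P(c) = P*` exactly;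
* `resonance_unavoidable`: the composition — a resonant leaf exists for every amplitude range
  `[0, P(c₁)]` containing the crossing window.
-/

namespace Summit.AnomalousDissipation.AnomalousDissipation.Theorems

/-- A continuous real multiplier family that is stable at `P₁` and unstable at `P₂ ≥ P₁` crosses
`μ = 1` in between. -/
theorem real_crossing_exists (μ : ℝ → ℝ) (P₁ P₂ : ℝ) (hle : P₁ ≤ P₂)
    (hμ : ContinuousOn μ (Set.Icc P₁ P₂)) (h₁ : μ P₁ < 1) (h₂ : 1 < μ P₂) :
    ∃ P ∈ Set.Icc P₁ P₂, μ P = 1 := by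
  have h : (1 : ℝ) ∈ Set.Icc (μ P₁) (μ P₂) := ⟨h₁.le, h₂.le⟩
  exact intermediate_value_Icc hle hμ h

/-- Across the live band the pattern parameter `P(c) = k · Re_p(c)` runs continuously from `0`
(contact leaf) to `P(c₁)`; once `P(c₁) ≥ P*`, some leaf carries exactly `P*`. -/
theorem resonant_leaf_exists (P : ℝ → ℝ) (c₀ c₁ Pstar : ℝ) (hle : c₀ ≤ c₁)
    (hP : ContinuousOn P (Set.Icc c₀ c₁)) (h0 : P c₀ = 0) (hstar : 0 ≤ Pstar) (h1 : Pstar ≤ P c₁) :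
    ∃ c ∈ Set.Icc c₀ c₁, P c = Pstar := by
  have h : Pstar ∈ Set.Icc (P c₀) (P c₁) := ⟨by rw [h0]; exact hstar, h1⟩
  exact intermediate_value_Icc hle hP h

/-- Composition: a real multiplier family `μ(P)` crossing `1` on `[P₁, P₂] ⊆ [0, P(c₁)]` and a
continuous amplitude profile `P(c)` from `0` to `P(c₁)` give a leaf `c` and a parameter value on it
with `μ = 1` — an exact periodic solution of the linearised leaf equation (a resonance of the steady
operator) inside the live band. -/
theorem resonance_unavoidable (μ P : ℝ → ℝ) (P₁ P₂ c₀ c₁ : ℝ) (hP12 : P₁ ≤ P₂) (hc : c₀ ≤ c₁)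
    (hμ : ContinuousOn μ (Set.Icc P₁ P₂)) (h₁ : μ P₁ < 1) (h₂ : 1 < μ P₂)
    (hP : ContinuousOn P (Set.Icc c₀ c₁)) (h0 : P c₀ = 0) (hP₁ : 0 ≤ P₁) (hreach : P₂ ≤ P c₁) :
    ∃ c ∈ Set.Icc c₀ c₁, μ (P c) = 1 := by
  obtain ⟨Pstar, hPs, hμs⟩ := real_crossing_exists μ P₁ P₂ hP12 hμ h₁ h₂
  obtain ⟨c, hcI, hPc⟩ := resonant_leaf_exists P c₀ c₁ Pstar hc hP h0 (le_trans hP₁ hPs.1)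
    (le_trans hPs.2 hreach)
  exact ⟨c, hcI, by rw [hPc]; exact hμs⟩

end Summit.AnomalousDissipation.AnomalousDissipation.Theorems
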